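import Mathlib
import HarnessLib
import Literature.Computability.AlgebraicComplexity.PatternExpressions
import Literature.Combinatorics.SimpleGraph.TreeDecomposition
import Summits.ValiantsHypothesis.ValiantsHypothesis.Theorems.MonotoneRestorationMonotoneRestorationQPLinearWidthForestBlindHomIndist

/-!
# Route MonotoneRestoration, crux `MonotoneRestorationQP` (stmt-15886), line `linear-width` —
# THE WIDTH SCALE IS STRICT AT THE BOTTOM: the `4`-cycle (treewidth `2`) separates the
# `HomIndist 4 2`-equivalent pair, so `HomIndist 4 3 ⊊ HomIndist 4 2`

Helper file (`--supports stmt-ValiantsHypothesis-15886`), def-free; sequel of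
`Theorems/…LinearWidthForestBlind.lean` / `…ForestBlindHomIndist.lean`.

* `treewidth_patternGraph_le_rows` — the pattern graph of ANY bipartite multigraph pattern on
  `Fin a ⊔ Fin b` has treewidth `≤ a` (path decomposition with bags "all row vertices + one column
  vertex", `treewidth_le_of_intervals`);
* `eval_homPoly_fourCycle` — `hom_{C_4,n}(X) = Σ_{i,i'} (Σ_j X_{ij} X_{i'j})²` for the `4`-cycle
  pattern `K_{2,2} = {(0,0),(0,1),(1,0),(1,1)}` on `Fin 2 ⊔ Fin 2`;
* `fourCycle_cycle8`, `fourCycle_twoSquares` — its values `24` and `32` at the biadjacency matrices of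
  the `8`-cycle and of two `4`-cycles;
* `exists_homIndist_two_not_three` — **at level `4` there are `A, B` with `HomIndist 4 2 A B` but NOT
  `HomIndist 4 3 A B`** (both unfolded verbatim): together with `DeterminedVsNarrow.homIndist_one`
  (`k = 1` trivial), `ForestBlind.exists_homIndist_two_not_perms` (`k = 2` is not isomorphism) and
  `OrbitSeparation.homIndist_iff_exists_perms` (`k ≥ 4·(n!)²` is isomorphism) this pins the shape of
  the scale the width hypothesis `PolylogHomDetermined` of `WidthRung d` lives on.

Honest label: calibration; no stub closed; VP ≠ VNP not moved. [cite: DwivediPagoSeppelt2026, Def. 3.2]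
-/

-- `Summit.ValiantsHypothesis.ValiantsHypothesis.…` is the tree's mandated namespace (Sub = Summit).
set_option linter.dupNamespace false

noncomputable section

namespace Summit.ValiantsHypothesis.ValiantsHypothesis.Theorems

namespace ForestBlind

open Literature.Computability.AlgebraicComplexity MvPolynomial SimpleGraph

/-! ### Every bipartite pattern has treewidth at most its number of row vertices -/

/-- **`tw ≤ a`** for the pattern graph of any pattern on `Fin a ⊔ Fin b`: the bags
`{all rows} ∪ {column t}`, `t < b`, form a path decomposition of width `a`. [folklore] -/
theorem treewidth_patternGraph_le_rows {a b : ℕ} (E : Multiset (Fin a × Fin b)) :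
    Literature.Combinatorics.SimpleGraph.treewidth
      (SimpleGraph.fromRel fun u v : Fin a ⊕ Fin b => ∃ p ∈ E, u = Sum.inl p.1 ∧ v = Sum.inr p.2) ≤ a := by
  classical
  rcases Nat.eq_zero_or_pos b with rfl | hb
  · refine (Literature.Combinatorics.SimpleGraph.treewidth_le_card_sub_one _).trans ?_
    simp
  obtain ⟨k, rfl⟩ : ∃ k, b = k + 1 := ⟨b - 1, by omega⟩
  let B : Fin (k + 1) → Finset (Fin a ⊕ Fin (k + 1)) := fun t =>
    insert (Sum.inr t) (Finset.univ.map Function.Embedding.inl)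
  have hrow : ∀ (i : Fin a) (t : Fin (k + 1)), (Sum.inl i : Fin a ⊕ Fin (k + 1)) ∈ B t :=
    fun i t => Finset.mem_insert_of_mem (Finset.mem_map_of_mem _ (Finset.mem_univ i))
  have hcol : ∀ j t : Fin (k + 1), (Sum.inr j : Fin a ⊕ Fin (k + 1)) ∈ B t ↔ j = t := by
    intro j t
    simp only [B, Finset.mem_insert, Sum.inr.injEq, Finset.mem_map, Finset.mem_univ,
      Function.Embedding.inl_apply, true_and, reduceCtorEq, exists_false, or_false]
  refine Literature.Combinatorics.SimpleGraph.treewidth_le_of_intervals _ B ?_ ?_ ?_ ?_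
  · intro u v huv
    rw [SimpleGraph.fromRel_adj] at huv
    rcases huv.2 with ⟨p, -, rfl, rfl⟩ | ⟨p, -, rfl, rfl⟩
    · exact ⟨p.2, hrow _ _, (hcol _ _).2 rfl⟩
    · exact ⟨p.2, (hcol _ _).2 rfl, hrow _ _⟩
  · rintro (i | j)
    · exact ⟨0, hrow i 0⟩
    · exact ⟨j, (hcol j j).2 rfl⟩
  · rintro (i | j)
    · have : {t : Fin (k + 1) | (Sum.inl i : Fin a ⊕ Fin (k + 1)) ∈ B t} = Set.univ :=
        Set.eq_univ_of_forall fun t => hrow i t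
      rw [this]
      exact Set.ordConnected_univ
    · have : {t : Fin (k + 1) | (Sum.inr j : Fin a ⊕ Fin (k + 1)) ∈ B t} = {j} := by
        ext t
        simp only [Set.mem_setOf_eq, Set.mem_singleton_iff, hcol]
        exact eq_comm
      rw [this]
      exact Set.ordConnected_singleton
  · intro t
    calc (B t).card ≤ (Finset.univ.map (Function.Embedding.inl : Fin a ↪ Fin a ⊕ Fin (k + 1))).card + 1 :=
          Finset.card_insert_le _ _
      _ = a + 1 := by simp

/-! ### The `4`-cycle polynomial -/

/-- **`hom_{C_4,n}(X) = Σ_{i,i'} (Σ_j X_{ij} X_{i'j})²`** for the pattern `K_{2,2}` on `Fin 2 ⊔ Fin 2`.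
[folklore] -/
theorem eval_homPoly_fourCycle {n : ℕ} (X : Fin n × Fin n → ℂ) :
    eval X (homPoly (((0, 0) ::ₘ (0, 1) ::ₘ (1, 0) ::ₘ {(1, 1)}) : Multiset (Fin 2 × Fin 2)) n ℂ) =
      ∑ i : Fin n, ∑ i' : Fin n, (∑ j : Fin n, X (i, j) * X (i', j)) ^ 2 := by
  rw [CaterpillarHom.eval_homPoly, Fintype.sum_prod_type]
  simp only [Multiset.map_cons, Multiset.map_singleton, Multiset.prod_cons, Multiset.prod_singleton]
  rw [Fintype.sum_equiv (finTwoArrowEquiv (Fin n)) _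
    (fun ii' : Fin n × Fin n => (∑ j : Fin n, X (ii'.1, j) * X (ii'.2, j)) ^ 2) ?_]
  · rw [Fintype.sum_prod_type]
  intro h₁
  rw [Fintype.sum_equiv (finTwoArrowEquiv (Fin n)) _
    (fun jj' : Fin n × Fin n => X (h₁ 0, jj'.1) * X (h₁ 0, jj'.2) * X (h₁ 1, jj'.1) * X (h₁ 1, jj'.2))
    (fun h₂ => by simp [finTwoArrowEquiv, mul_assoc])]
  rw [Fintype.sum_prod_type, sq, Finset.sum_mul_sum]
  simp only [finTwoArrowEquiv_apply]
  refine Finset.sum_congr rfl fun j _ => Finset.sum_congr rfl fun j' _ => ?_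
  dsimp [finTwoArrowEquiv, piFinTwoEquiv]
  ring

/-- `hom_{C_4,4}` at the `8`-cycle: `24`. [folklore] -/
theorem fourCycle_cycle8 :
    ∑ i : Fin 4, ∑ i' : Fin 4, (∑ j : Fin 4,
      (((![![1,1,0,0],![0,1,1,0],![0,0,1,1],![1,0,0,1]] : Fin 4 → Fin 4 → ℕ) i j : ℕ) : ℂ) *
      (((![![1,1,0,0],![0,1,1,0],![0,0,1,1],![1,0,0,1]] : Fin 4 → Fin 4 → ℕ) i' j : ℕ) : ℂ)) ^ 2 =
      24 := by
  simp [Fin.sum_univ_four]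
  norm_num

/-- `hom_{C_4,4}` at two `4`-cycles: `32`. [folklore] -/
theorem fourCycle_twoSquares :
    ∑ i : Fin 4, ∑ i' : Fin 4, (∑ j : Fin 4,
      (((![![1,1,0,0],![1,1,0,0],![0,0,1,1],![0,0,1,1]] : Fin 4 → Fin 4 → ℕ) i j : ℕ) : ℂ) *
      (((![![1,1,0,0],![1,1,0,0],![0,0,1,1],![0,0,1,1]] : Fin 4 → Fin 4 → ℕ) i' j : ℕ) : ℂ)) ^ 2 =
      32 := by
  simp [Fin.sum_univ_four]
  norm_num

/-! ### Strictness of the scale at `k = 2 < 3` -/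

/-- **`HomIndist 4 3 ⊊ HomIndist 4 2`.**  The biadjacency matrices of the `8`-cycle and of two `4`-cycles
are hom-indistinguishable below treewidth `2` but NOT below treewidth `3` (the `4`-cycle, treewidth
`≤ 2`, takes the values `24 ≠ 32`); both clauses are the line's `HomIndist`, unfolded verbatim.
[folklore] -/
theorem exists_homIndist_two_not_three :
    ∃ A B : Fin 4 × Fin 4 → ℂ,
      (∀ (a b : ℕ) (E : Multiset (Fin a × Fin b)),
        Literature.Combinatorics.SimpleGraph.treewidth
          (SimpleGraph.fromRel fun u v : Fin a ⊕ Fin b =>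
            ∃ p ∈ E, u = Sum.inl p.1 ∧ v = Sum.inr p.2) < 2 →
        eval A (homPoly E 4 ℂ) = eval B (homPoly E 4 ℂ)) ∧
      ¬ (∀ (a b : ℕ) (E : Multiset (Fin a × Fin b)),
        Literature.Combinatorics.SimpleGraph.treewidth
          (SimpleGraph.fromRel fun u v : Fin a ⊕ Fin b =>
            ∃ p ∈ E, u = Sum.inl p.1 ∧ v = Sum.inr p.2) < 3 →
        eval A (homPoly E 4 ℂ) = eval B (homPoly E 4 ℂ)) := by
  refine ⟨fun ij => (((![![1,1,0,0],![0,1,1,0],![0,0,1,1],![1,0,0,1]] : Fin 4 → Fin 4 → ℕ)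
      ij.1 ij.2 : ℕ) : ℂ),
    fun ij => (((![![1,1,0,0],![1,1,0,0],![0,0,1,1],![0,0,1,1]] : Fin 4 → Fin 4 → ℕ)
      ij.1 ij.2 : ℕ) : ℂ), ?_, fun h => ?_⟩
  · exact homIndist_two_of_equidistributed _ _
      (fun m i i' => (rows_cycle8 m i).trans (rows_twoSquares m i').symm)
      (fun m j j' => (cols_cycle8 m j).trans (cols_twoSquares m j').symm)
  · have h4 := h 2 2 ((0, 0) ::ₘ (0, 1) ::ₘ (1, 0) ::ₘ {(1, 1)})
      ((treewidth_patternGraph_le_rows _).trans_lt (by norm_num))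
    rw [eval_homPoly_fourCycle, eval_homPoly_fourCycle] at h4
    have h24 := fourCycle_cycle8
    have h32 := fourCycle_twoSquares
    simp only at h4 h24 h32
    rw [h24, h32] at h4
    norm_num at h4

end ForestBlind

end Summit.ValiantsHypothesis.ValiantsHypothesis.Theorems

end
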